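import Literature.Analysis.FluidPDE.OnsagerBDSVThreeStages
import Literature.Analysis.FluidPDE.FractionalNSReynolds
import HarnessLib

/-!
# De Rosa's convex-integration scheme: the three stages of the proof of the inductive
# proposition (named facts)

L. De Rosa, *Infinitely many Leray–Hopf solutions for the fractional Navier–Stokes equations*,
Comm. PDE 44 (2019) 335–365 = arXiv:1801.10235, proves his main iterative proposition
(Prop. 4.1) in §5 "Following the construction of [BDLSV2017]" in three stages — *mollification*
(§5.1), *gluing* (§5.2) and *perturbation* (§§5.3–5.5) — which modify the Buckmaster–De Lellis–
Székelyhidi–Vicol (BDSV) stages (CPAM 72 (2019), §§2.4–2.6; in the tree the named facts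
`BDSV.mollificationStage`, `BDSV.gluingStage`, `BDSV.perturbationStage` of
`OnsagerBDSVThreeStages.lean`) for the fractional Navier–Stokes–Reynolds system (NSR)
`∂ₜv + div(v ⊗ v) + ∇p + ν(-Δ)^γ v = div R̊` in three places: the mollified triple solves (NSR)
again (§5.1, the display after (5.3)); the gluing uses exact smooth solutions of the fractional
Navier–Stokes system (§3.2, Thm. 3.4, Prop. 3.5) on forward intervals `0 ≤ t - tᵢ ≤ 2τ_q` with
the stability estimates of §3.1 (Props. 3.2–3.3), whence Cor. 5.2, Props. 5.3–5.5; and the new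
stress has a dissipative part `R̊^D_{q+1} = ν ℛ(-Δ)^γ w_{q+1}` (§5.5, (5.39), Prop. 5.13, using
Thm. 7.1 and Prop. 8.2). This file transcribes De Rosa's three stages as **named facts**, in the
shape of their BDSV twins; the sibling file `DeRosaStages.lean` glues them (theorem
`DeRosa.stageEstimates_of_threeStages`) into the seven stage estimates consumed by the proof of
Prop. 4.1 (`DeRosa.stepAt_of_threeStages`, `DeRosa.iterativeSchemeLT_of_threeStages`,
`DeRosaStagesProofs.lean`); the mollification stage is discharged
(`DeRosa.mollificationStage_holds`, `DeRosaMollificationProofs.lean`):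

* `DeRosa.mollificationStage` = Prop. 5.1 with the (NSR) system for the mollified triple: from a
  smooth solution `(v_q, p_q, R̊_q)` of (NSR) on `[0,T] × 𝕋³` with (4.7)–(4.8), a smooth solution
  `(v_ℓ, p_ℓ, R̊_ℓ)` of (NSR) with (5.5)–(5.8) for every `N`, whose velocity keeps every
  spatial Hölder bound of `v_q` and whose time-zero slice depends only on `v_q(·,0)`;
* `DeRosa.gluingStage` = §5.2 (Cor. 5.2, Props. 5.3, 5.4, 5.5 and the glued triple): from
  `(v_ℓ, p_ℓ, R̊_ℓ)` with (5.6)–(5.7′) and a spatial Hölder bound `[v_ℓ(t)]_θ ≤ C_H`, `γ < θ < β`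
  (the bound "`‖v_q‖_{γ'} ≤ 1`" used in the proof of (5.18), p. 14), a smooth solution
  `(v̄_q, p̄_q, R̊̄_q)` of (NSR) with `supp R̊̄_q ⊂ ⋃ᵢ Iᵢ × 𝕋³`, (5.13)|₀, (5.15)–(5.18) for
  `N ≤ N̄`, and `v̄_q(·,0) = v_ℓ(·,0)`;
* `DeRosa.perturbationStage` = §§5.3–5.5 (Lemmas 5.8–5.10, Props. 5.11, 5.12, 5.13): from
  `(v̄_q, p̄_q, R̊̄_q)` with the support property, `‖v̄_q‖₀ ≲ 1`, (5.15)–(5.17) for `N ≤ N̄`, a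
  spatial Hölder bound `[v̄_q(t)]_θ ≤ C_H` (used in the proof of (5.31), p. 15) and the energy gap
  "`δ_{q+1}/(2λ_q^α) ≤ e(t) - ∫|v̄_q|² ≤ 2δ_{q+1}`" (§5.3), a smooth solution
  `(v_{q+1}, p_{q+1}, R̊_{q+1})` of (NSR) with (5.19)–(5.21), whose time-zero velocity slice
  depends on the profile and the input only through `(e(0), v̄_q(·,0))`.

## Transcription (see also `DeRosaStages.lean`, `DeRosaStep.lean`)

* Vocabulary of the BDSV files: `BDSV.freq`, `BDSV.amp` ((4.5)–(4.6)), `BDSV.mollScale` = `ℓ`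
  ((5.3)), `BDSV.glueScale` = `τ_q` ((5.7)), `BDSV.SupLE` / `BDSV.DerivSupLE` (`‖·‖₀`, `[·]₁`,
  §3 of the paper), `BDSV.HolderSupLE T f N r B` (`‖f‖_{N+r} ≤ B` through the accepted
  `Torus.eContDiffHolderNorm`), `BDSV.advectiveDeriv T u S = ∂ₜS + (u·∇)S` ((5.17):
  `∂ₜ + v̄_q·∇`), `BDSV.SupportedOnGlueIntervals T τ S` (`S(t) = 0` off `⋃ₙ [nτ + τ/3, nτ + 2τ/3]`).
  De Rosa's intervals `Iᵢ = [t_{i+1} + τ_q/3, t_{i+1} + 2τ_q/3]` (§5.2, shifted forward with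
  respect to BDSV's because his stability estimates are one-sided in time) are among BDSV's
  `[nτ_q + τ_q/3, nτ_q + 2τ_q/3]`, `n ≥ 1`, so his support property implies the predicate.
* Triples are smooth solutions of (NSR), `Torus.IsFracNSReynoldsOn (Icc 0 T) γ ν`
  (`FractionalNSReynolds.lean`; normalisations (4.3)–(4.4) not demanded, as in `DeRosaScheme.lean`).
* Exponents and constants: `α` real, Hölder exponents `Real.toNNReal α` inside `HolderSupLE`; the
  extra Hölder exponent `θ` and the Hölder constants `C_H` are `ℝ≥0` (`HolderWith C_H θ (f t)`,
  quotient metric of `𝕋³`); implicit constants of `≲` ("independent of `a, b` and `q`") are reals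
  quantified before the threshold `a₀`, which may depend on everything quantified before it; the
  viscosity `ν ∈ (0,1)` ("`ν < 1`", §4.1; Prop. 5.3: "`0 < ν < 1`") and `T > 0` come after `a`.
* Regime: the gluing and perturbation stages are stated for `0 < γ < β < 1/3` with a Hölder
  hypothesis at an exponent `θ ∈ (γ, β)`, the regime covered by the printed proofs (proof of
  (5.18), p. 14; of (5.12), p. 13; of (5.31), p. 15 — see `DeRosaStep.lean`); the mollification
  stage does not involve the dissipation beyond the linear identity
  `(-Δ)^γ (v_q * ψ_ℓ) = ((-Δ)^γ v_q) * ψ_ℓ` and is stated for all `γ ∈ (0,1)`, `ν > 0` (the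
  standing range of §3.2).
* Time zero ("`v_{q+1}(·,0)` depends only on `e(0)` and `v_q(·,0)`", Prop. 4.1): stage by stage,
  `v_ℓ(·,0) = (v_q * ψ_ℓ)(·,0)` is a function `Ψ₁` of `v_q(·,0)` fixed with `ℓ` and the kernel;
  `v̄_q(·,0) = χ₀(0) v₀(·,0) = v_ℓ(·,0)` (`0 ∈ J₀`, `t₀ = 0`, (5.8′)); and `v_{q+1}(·,0) =
  v̄_q(·,0) + w_{q+1}(·,0)` with `w_{q+1}(·,0)` determined by
  `ρ_q(0) = (e(0) - δ_{q+2}/2 - ∫|v̄_q(·,0)|²)/3`, the cut-off `η₀(·,0)` and the Mikado profiles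
  (`R̊̄_q(·,0) = 0`, `Φ₀(·,0) = id`; §5.4: "the dependence of `w_{q+1}(·,0)` on the function
  `e(t)` is only trough the value `e(0)`"), a function `Ψ₃` of `(e(0), v̄_q(·,0))` fixed before
  the profile and the input.

## References

* L. De Rosa, Comm. PDE 44 (2019), 335–365 = arXiv:1801.10235: §3 (Props. 3.2, 3.3, Thm. 3.4,
  Prop. 3.5); §4.1 ((4.2)–(4.12)); §5 ((5.1)–(5.4)); §5.1 (Prop. 5.1, (5.5)–(5.8), the (NSR)
  system for `(v_ℓ, p_ℓ, R̊_ℓ)`); §5.2 ((5.7), (5.8′), Cor. 5.2, Props. 5.3–5.5, the glued triple,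
  `Iᵢ`, `Jᵢ`); §5.3 (energy gap, (5.19)–(5.21), Lemmas 5.6, 5.8, 5.9); §5.4 (Lemma 5.10, `M`,
  `w_o`, `w_c`, time zero); §5.5 ((5.38)–(5.40), Props. 5.11–5.13). [`Derosa2018`]
* T. Buckmaster, C. De Lellis, L. Székelyhidi Jr., V. Vicol, CPAM 72 (2019) = arXiv:1701.08678,
  §§2.4–2.6, Prop. 2.2, Props. 4.2–4.4, Cor. 5.8, Props. 6.1–6.2. [`BuckmasterEtAl2018`]
-/

open MeasureTheory Set
open scoped NNReal ENNReal ContDiff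

noncomputable section

namespace Literature.Analysis.FluidPDE

namespace DeRosa

/-- The flat three-torus `𝕋³ = (ℝ/ℤ)³`, local notation. -/
local notation "𝕋³" => UnitAddTorus (Fin 3)

/-- Euclidean `ℝ³`, local notation. -/
local notation "ℝ³" => EuclideanSpace ℝ (Fin 3)

/-- **De Rosa mollification stage** (De Rosa 2019, §5.1, Prop. 5.1 with the system solved by
the mollified triple: "we mollify `v_q` (in space) at length scale (5.3) `ℓ` … `v_ℓ := v_q * ψ_ℓ`,
`R̊_ℓ := R̊_q * ψ_ℓ - (v_q ⊗̊ v_q) * ψ_ℓ + v_ℓ ⊗̊ v_ℓ`. These functions obey the equation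
`∂ₜv_ℓ + div(v_ℓ ⊗ v_ℓ) + ∇p_ℓ + ν(-Δ)^γ v_ℓ = div R̊_ℓ`, `div v_ℓ = 0`, in view of (NSR)",
and Prop. 5.1: (5.5) `‖v_ℓ - v_q‖₀ ≲ δ_{q+1}^{1/2} λ_q^{-α}`, (5.6) `‖v_ℓ‖_{N+1} ≲ δ_q^{1/2} λ_q ℓ^{-N}`,
(5.7′) `‖R̊_ℓ‖_{N+α} ≲ δ_{q+1} ℓ^{-N+α}`, (5.8) `|∫ |v_q|² - |v_ℓ|²| ≲ δ_{q+1} ℓ^α`, "we refer to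
[BDLSV2017] for a detailed proof" = BDSV Prop. 2.2). For every `M > 0`, `0 < β < 1/3`,
`1 < b < (1-β)/(2β)` there is `α₀ > 0` such that for `0 < α < α₀` there are constants `C_N`
(`N ∈ ℕ`) and `a₀ > 1` such that for all `a ≥ a₀`, every exponent `γ ∈ (0,1)` and viscosity
`ν > 0`, every `T > 0` and `q` there is a map `Ψ₁` with: for every smooth solution
`(v_q, p_q, R̊_q)` of (NSR) on `[0,T] × 𝕋³` (`Torus.IsFracNSReynoldsOn (Icc 0 T) γ ν`) with (4.7)
`‖R̊_q‖₀ ≤ δ_{q+1} λ_q^{-3α}` and (4.8) `‖v_q‖₁ ≤ M δ_q^{1/2} λ_q`, the mollified triple is a smooth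
solution of (NSR) on `[0,T] × 𝕋³` satisfying (5.5)–(5.8) for every `N` (constants `C_N`; (5.5),
(5.8) with `C_0`), its velocity keeps every spatial Hölder bound of `v_q`
(`[v_ℓ(t)]_r ≤ [v_q(t)]_r`: mollification with a standard kernel), and `v_ℓ(·,0) = Ψ₁ (v_q(·,0))`.
Transcription as in `BDSV.mollificationStage` (`BDSV.HolderSupLE`, `ℓ = BDSV.mollScale`).
[cite: Derosa2018, §5.1 Prop. 5.1 and the display after (5.3)] -/
def mollificationStage : Prop :=
  ∀ M : ℝ, 0 < M → ∀ β : ℝ, 0 < β → β < 1 / 3 → ∀ b : ℝ, 1 < b → b < (1 - β) / (2 * β) →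
    ∃ α₀ : ℝ, 0 < α₀ ∧ ∀ α : ℝ, 0 < α → α < α₀ →
      ∃ (C : ℕ → ℝ) (a₀ : ℝ), 1 < a₀ ∧ ∀ a : ℝ, a₀ ≤ a → ∀ γ : ℝ, 0 < γ → γ < 1 →
        ∀ ν : ℝ, 0 < ν → ∀ T : ℝ, 0 < T → ∀ q : ℕ, ∃ Ψ₁ : (𝕋³ → ℝ³) → (𝕋³ → ℝ³),
          ∀ (v : ℝ → 𝕋³ → ℝ³) (p : ℝ → 𝕋³ → ℝ) (R : ℝ → 𝕋³ → Fin 3 → ℝ³),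
            Torus.IsFracNSReynoldsOn (Icc 0 T) γ ν v p R →
            BDSV.SupLE T R (BDSV.amp β a b (q + 1) * BDSV.freq a b q ^ (-3 * α)) →
            (∃ B₀ B₁ : ℝ, BDSV.SupLE T v B₀ ∧ BDSV.DerivSupLE T v B₁ ∧
              B₀ + B₁ ≤ M * Real.sqrt (BDSV.amp β a b q) * BDSV.freq a b q) →
              ∃ (vℓ : ℝ → 𝕋³ → ℝ³) (pℓ : ℝ → 𝕋³ → ℝ) (Rℓ : ℝ → 𝕋³ → Fin 3 → ℝ³),
                Torus.IsFracNSReynoldsOn (Icc 0 T) γ ν vℓ pℓ Rℓ ∧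
                BDSV.SupLE T (fun t x => vℓ t x - v t x)
                  (C 0 * (Real.sqrt (BDSV.amp β a b (q + 1)) * BDSV.freq a b q ^ (-α))) ∧
                (∀ N : ℕ, BDSV.HolderSupLE T vℓ (N + 1) 0
                  (C N * (Real.sqrt (BDSV.amp β a b q) * BDSV.freq a b q *
                    BDSV.mollScale β α a b q ^ (-(N : ℝ))))) ∧
                (∀ N : ℕ, BDSV.HolderSupLE T Rℓ N (Real.toNNReal α)
                  (C N * (BDSV.amp β a b (q + 1) * BDSV.mollScale β α a b q ^ (-(N : ℝ) + α)))) ∧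
                (∀ t ∈ Icc 0 T, |(∫ x, ‖v t x‖ ^ 2) - ∫ x, ‖vℓ t x‖ ^ 2| ≤
                  C 0 * (BDSV.amp β a b (q + 1) * BDSV.mollScale β α a b q ^ α)) ∧
                (∀ (r CH : ℝ≥0), (∀ t ∈ Icc 0 T, HolderWith CH r (v t)) →
                  ∀ t ∈ Icc 0 T, HolderWith CH r (vℓ t)) ∧
                vℓ 0 = Ψ₁ (v 0)

/-- **De Rosa gluing stage** (De Rosa 2019, §5.2: "we glue together exact solutions to the
fractional Navier-Stokes equations in order to produce a new `v̄_q`, close to `v_q`, whose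
associated Reynolds stress error has support in pairwise disjoint temporal regions of length
`τ_q` in time", (5.7) `τ_q = ℓ^{2α} δ_q^{-1/2} λ_q^{-1}`, the exact solutions (5.8′) with
`vᵢ(·,tᵢ) = v_ℓ(·,tᵢ)`, `tᵢ = iτ_q` (Prop. 3.5), Cor. 5.2, Prop. 5.3 (stability, "`0 < ν < 1`"),
Prop. 5.4 (vector potentials), the cut-offs `χᵢ` and the triple `(v̄_q, p̄_q, R̊̄_q)` solving (NSR)
with `supp R̊̄_q ⊂ 𝕋³ × ⋃ᵢ Iᵢ`, and Prop. 5.5: (5.13) `‖v̄_q - v_ℓ‖_α ≲ δ_{q+1}^{1/2} ℓ^α`,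
(5.15) `‖v̄_q‖_{1+N} ≲ δ_q^{1/2} λ_q ℓ^{-N}`, (5.16) `‖R̊̄_q‖_{N+α} ≲ δ_{q+1} ℓ^{-N+α}`,
(5.17) `‖(∂ₜ + v̄_q·∇)R̊̄_q‖_{N+α} ≲ δ_{q+1} δ_q^{1/2} λ_q ℓ^{-N-α}`,
(5.18) `|∫ |v̄_q|² - |v_ℓ|²| ≲ δ_{q+1} ℓ^α` — the proof of (5.18), p. 14, using the spatial Hölder
bound "`‖v_q‖_{γ'} ≤ 1` for every `γ' < β`" at an exponent above `γ`). For every `M > 0`,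
`0 < γ < β < 1/3`, `1 < b < min{(1-β)/(2β), 4/3}` and `θ ∈ (γ, β)` there is `α₀ > 0` such that
for `0 < α < α₀`, every `N̄`, every family of input constants `(C_N)` and every Hölder constant
`C_H` there are `C` and `a₀ > 1` such that for all `a ≥ a₀`, `ν ∈ (0,1)`, `T > 0`, `q` and every
smooth solution `(v_ℓ, p_ℓ, R̊_ℓ)` of (NSR) on `[0,T] × 𝕋³` with (5.6)
`‖v_ℓ‖_{N+1} ≤ C_N δ_q^{1/2} λ_q ℓ^{-N}`, (5.7′) `‖R̊_ℓ‖_{N+α} ≤ C_N δ_{q+1} ℓ^{-N+α}` (all `N`) and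
`[v_ℓ(t)]_θ ≤ C_H` (`t ∈ [0,T]`), there is a smooth solution `(v̄_q, p̄_q, R̊̄_q)` of (NSR) on
`[0,T] × 𝕋³` whose stress vanishes off the glue intervals (`BDSV.SupportedOnGlueIntervals`,
implied by `supp R̊̄_q ⊂ ⋃ᵢ Iᵢ`, `Iᵢ = [t_{i+1} + τ_q/3, t_{i+1} + 2τ_q/3]`), with, for `N ≤ N̄`,
(5.13)|₀ `‖v̄_q - v_ℓ‖₀ ≤ C δ_{q+1}^{1/2} ℓ^α`, (5.15), (5.16), (5.17), and (5.18), and with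
`v̄_q(·,0) = v_ℓ(·,0)` (`v̄_q = v₀` on `J₀ ∋ 0` and `v₀(·,t₀) = v_ℓ(·,0)`). Transcription as in
`BDSV.gluingStage`. [cite: Derosa2018, §5.2 (Cor. 5.2, Props. 5.3–5.5, (5.7), (5.13)–(5.18))] -/
def gluingStage : Prop :=
  ∀ M : ℝ, 0 < M → ∀ β : ℝ, 0 < β → β < 1 / 3 → ∀ γ : ℝ, 0 < γ → γ < β →
    ∀ b : ℝ, 1 < b → b < (1 - β) / (2 * β) → b < 4 / 3 →
      ∀ θ : ℝ≥0, γ < (θ : ℝ) → (θ : ℝ) < β →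
        ∃ α₀ : ℝ, 0 < α₀ ∧ ∀ α : ℝ, 0 < α → α < α₀ →
          ∀ (Nbar : ℕ) (Cin : ℕ → ℝ) (CH : ℝ≥0),
            ∃ (C a₀ : ℝ), 1 < a₀ ∧ ∀ a : ℝ, a₀ ≤ a → ∀ ν : ℝ, 0 < ν → ν < 1 →
              ∀ T : ℝ, 0 < T →
                ∀ (q : ℕ) (vℓ : ℝ → 𝕋³ → ℝ³) (pℓ : ℝ → 𝕋³ → ℝ) (Rℓ : ℝ → 𝕋³ → Fin 3 → ℝ³),
                  Torus.IsFracNSReynoldsOn (Icc 0 T) γ ν vℓ pℓ Rℓ →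
                  (∀ N : ℕ, BDSV.HolderSupLE T vℓ (N + 1) 0
                    (Cin N * (Real.sqrt (BDSV.amp β a b q) * BDSV.freq a b q *
                      BDSV.mollScale β α a b q ^ (-(N : ℝ))))) →
                  (∀ N : ℕ, BDSV.HolderSupLE T Rℓ N (Real.toNNReal α)
                    (Cin N * (BDSV.amp β a b (q + 1) * BDSV.mollScale β α a b q ^ (-(N : ℝ) + α)))) →
                  (∀ t ∈ Icc 0 T, HolderWith CH θ (vℓ t)) →
                    ∃ (vbar : ℝ → 𝕋³ → ℝ³) (pbar : ℝ → 𝕋³ → ℝ) (Rbar : ℝ → 𝕋³ → Fin 3 → ℝ³),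
                      Torus.IsFracNSReynoldsOn (Icc 0 T) γ ν vbar pbar Rbar ∧
                      BDSV.SupportedOnGlueIntervals T (BDSV.glueScale β α a b q) Rbar ∧
                      BDSV.SupLE T (fun t x => vbar t x - vℓ t x)
                        (C * (Real.sqrt (BDSV.amp β a b (q + 1)) * BDSV.mollScale β α a b q ^ α)) ∧
                      (∀ N : ℕ, N ≤ Nbar → BDSV.HolderSupLE T vbar (N + 1) 0
                        (C * (Real.sqrt (BDSV.amp β a b q) * BDSV.freq a b q *
                          BDSV.mollScale β α a b q ^ (-(N : ℝ))))) ∧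
                      (∀ N : ℕ, N ≤ Nbar → BDSV.HolderSupLE T Rbar N (Real.toNNReal α)
                        (C * (BDSV.amp β a b (q + 1) * BDSV.mollScale β α a b q ^ (-(N : ℝ) + α)))) ∧
                      (∀ N : ℕ, N ≤ Nbar →
                        BDSV.HolderSupLE T (BDSV.advectiveDeriv T vbar Rbar) N (Real.toNNReal α)
                          (C * (BDSV.amp β a b (q + 1) * Real.sqrt (BDSV.amp β a b q) *
                            BDSV.freq a b q * BDSV.mollScale β α a b q ^ (-(N : ℝ) - α)))) ∧
                      (∀ t ∈ Icc 0 T, |(∫ x, ‖vbar t x‖ ^ 2) - ∫ x, ‖vℓ t x‖ ^ 2| ≤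
                        C * (BDSV.amp β a b (q + 1) * BDSV.mollScale β α a b q ^ α)) ∧
                      vbar 0 = vℓ 0

/-- **De Rosa perturbation stage** (De Rosa 2019, §§5.3–5.5: "Starting with the solution
`(v̄_q, p̄_q, R̊̄_q)`, we then produce a new solution `(v_{q+1}, p_{q+1}, R̊_{q+1})` of the
Navier-Stokes Reynolds system (NSR) with estimates (5.19)
`‖v_{q+1} - v̄_q‖₀ + λ_{q+1}^{-1}‖v_{q+1} - v̄_q‖₁ ≤ (M/2) δ_{q+1}^{1/2}`, (5.20)
`‖R̊_{q+1}‖_α ≲ δ_{q+1}^{1/2} δ_q^{1/2} λ_q λ_{q+1}^{-1+4α}`, (5.21)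
`|e(t) - ∫ |v_{q+1}|² - δ_{q+2}/2| ≲ δ_q^{1/2} δ_{q+1}^{1/2} λ_q^{1+2α} λ_{q+1}^{-1}`,
cf. Propositions 5.11, 5.12 and 5.13", given the energy gap "`δ_{q+1}/(2λ_q^α) ≤ e(t) - ∫|v̄_q|² ≤
2δ_{q+1}`" (§5.3); the construction — Mikado flows (Lemma 5.6) along the backward flows `Φᵢ` of
`v̄_q`, cut-offs `ηᵢ` (Lemma 5.8), `ρ_q`, `ρ_{q,i}`, `R̃_{q,i}` (Lemma 5.9, whose proof, p. 15,
bounds `2ν∫|(-Δ)^{γ/2} v̄_q|²` by a spatial Hölder bound of `v̄_q` above `γ`), the constant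
`M = 64 M̄ ∑_{k≠0} |k|^{-4}` (Lemma 5.10, (5.37)), `w_{q+1} = w_o + w_c`, and the new stress
`R̊_{q+1} = R̊^E_{q+1} + ν ℛ(-Δ)^γ w_{q+1}` ((5.38)–(5.40)) with Props. 5.11–5.13 (the last using
`b < 4/3` and `γ < 1/3`) — is §§5.3–5.5 with §§6–8). There is a universal `M > 0` such that for
`0 < γ < β < 1/3`, `1 < b < min{(1-β)/(2β), 4/3}` and `θ ∈ (γ, β)` there is `α₀ > 0` such that for
`0 < α < α₀` there is a number of derivatives `N̄` such that for all constants `C_in`, `C₀` and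
every Hölder constant `C_H` there are `C` and `a₀ > 1` such that for all `a ≥ a₀`, `ν ∈ (0,1)`,
`T > 0` and `q` there is a map `Ψ₃` with: for every normalised profile `e` on `[0,T]` ((4.2),
`BDSV.IsNormalisedProfile`) and every smooth solution `(v̄_q, p̄_q, R̊̄_q)` of (NSR) on
`[0,T] × 𝕋³` whose stress vanishes off the glue intervals, with `‖v̄_q‖₀ ≤ C₀`, (5.15)–(5.17) for
`N ≤ N̄` (constant `C_in`), `[v̄_q(t)]_θ ≤ C_H` (`t ∈ [0,T]`) and the energy gap on `[0,T]`, there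
is a smooth solution `(v_{q+1}, p_{q+1}, R̊_{q+1})` of (NSR) on `[0,T] × 𝕋³` with (5.19)
(`BDSV.VelocityIncrementBound (M/2)`), (5.20) in the form of Prop. 5.13
`‖R̊_{q+1}‖₀ ≤ C δ_{q+1}^{1/2} δ_q^{1/2} λ_q λ_{q+1}^{-1+4α}`, (5.21) (Prop. 5.12), and
`v_{q+1}(·,0) = Ψ₃ (e(0)) (v̄_q(·,0))` (§5.4: "the dependence of `w_{q+1}(·,0)` on the function
`e(t)` is only trough the value `e(0)`"). Transcription as in `BDSV.perturbationStage`.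
[cite: Derosa2018, §5.3 (5.19)–(5.21), Lemma 5.9; §5.4 (5.37); §5.5 Props. 5.11–5.13] -/
def perturbationStage : Prop :=
  ∃ M : ℝ, 0 < M ∧
    ∀ β : ℝ, 0 < β → β < 1 / 3 → ∀ γ : ℝ, 0 < γ → γ < β →
      ∀ b : ℝ, 1 < b → b < (1 - β) / (2 * β) → b < 4 / 3 →
        ∀ θ : ℝ≥0, γ < (θ : ℝ) → (θ : ℝ) < β →
          ∃ α₀ : ℝ, 0 < α₀ ∧ ∀ α : ℝ, 0 < α → α < α₀ → ∃ Nbar : ℕ,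
            ∀ (Cin C₀ : ℝ) (CH : ℝ≥0),
              ∃ (C a₀ : ℝ), 1 < a₀ ∧ ∀ a : ℝ, a₀ ≤ a → ∀ ν : ℝ, 0 < ν → ν < 1 →
                ∀ T : ℝ, 0 < T → ∀ q : ℕ, ∃ Ψ₃ : ℝ → (𝕋³ → ℝ³) → (𝕋³ → ℝ³),
                  ∀ e : ℝ → ℝ, BDSV.IsNormalisedProfile T e →
                    ∀ (vbar : ℝ → 𝕋³ → ℝ³) (pbar : ℝ → 𝕋³ → ℝ) (Rbar : ℝ → 𝕋³ → Fin 3 → ℝ³),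
                      Torus.IsFracNSReynoldsOn (Icc 0 T) γ ν vbar pbar Rbar →
                      BDSV.SupportedOnGlueIntervals T (BDSV.glueScale β α a b q) Rbar →
                      BDSV.SupLE T vbar C₀ →
                      (∀ N : ℕ, N ≤ Nbar → BDSV.HolderSupLE T vbar (N + 1) 0
                        (Cin * (Real.sqrt (BDSV.amp β a b q) * BDSV.freq a b q *
                          BDSV.mollScale β α a b q ^ (-(N : ℝ))))) →
                      (∀ N : ℕ, N ≤ Nbar → BDSV.HolderSupLE T Rbar N (Real.toNNReal α)
                        (Cin * (BDSV.amp β a b (q + 1) * BDSV.mollScale β α a b q ^ (-(N : ℝ) + α)))) →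
                      (∀ N : ℕ, N ≤ Nbar →
                        BDSV.HolderSupLE T (BDSV.advectiveDeriv T vbar Rbar) N (Real.toNNReal α)
                          (Cin * (BDSV.amp β a b (q + 1) * Real.sqrt (BDSV.amp β a b q) *
                            BDSV.freq a b q * BDSV.mollScale β α a b q ^ (-(N : ℝ) - α)))) →
                      (∀ t ∈ Icc 0 T, HolderWith CH θ (vbar t)) →
                      (∀ t ∈ Icc 0 T,
                        BDSV.amp β a b (q + 1) * BDSV.freq a b q ^ (-α) / 2 ≤
                            e t - ∫ x, ‖vbar t x‖ ^ 2 ∧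
                          e t - ∫ x, ‖vbar t x‖ ^ 2 ≤ 2 * BDSV.amp β a b (q + 1)) →
                        ∃ (v' : ℝ → 𝕋³ → ℝ³) (p' : ℝ → 𝕋³ → ℝ) (R' : ℝ → 𝕋³ → Fin 3 → ℝ³),
                          Torus.IsFracNSReynoldsOn (Icc 0 T) γ ν v' p' R' ∧
                          BDSV.VelocityIncrementBound (M / 2) β a b T q
                            (fun t x => v' t x - vbar t x) ∧
                          BDSV.SupLE T R' (C * (Real.sqrt (BDSV.amp β a b (q + 1)) *
                            Real.sqrt (BDSV.amp β a b q) * BDSV.freq a b q *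
                            BDSV.freq a b (q + 1) ^ (-1 + 4 * α))) ∧
                          (∀ t ∈ Icc 0 T,
                            |e t - (∫ x, ‖v' t x‖ ^ 2) - BDSV.amp β a b (q + 2) / 2| ≤
                              C * (Real.sqrt (BDSV.amp β a b q) * Real.sqrt (BDSV.amp β a b (q + 1)) *
                                BDSV.freq a b q ^ (1 + 2 * α) * (BDSV.freq a b (q + 1))⁻¹)) ∧
                          v' 0 = Ψ₃ (e 0) (vbar 0)

end DeRosa

end Literature.Analysis.FluidPDE
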